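import Literature.NumberTheory.LFunctions.HardyZRiemannSiegelEvaluation
import Literature.NumberTheory.LFunctions.RiemannSiegelRemainderRational
import HarnessLib

/-!
# The Riemann–Siegel evaluator and run checker on the proved SHARP remainder (rational constants)

Topic `Literature/NumberTheory/LFunctions` (with `Analysis/ValidatedNumerics`). A drop-in variant of
`RSEval.hardyZBox` / `RSCert.checkChunk` (`HardyZRiemannSiegelEvaluation.lean`,
`RiemannHypothesisUpToRSCertificate.lean`) whose remainder term is the tree's PROVED sharp bound
`Literature.NumberTheory.LFunctions.Gabcke.abs_R0_le_sharp_rat` (`RiemannSiegelRemainderRational.lean`,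
Gabcke's direct `K = 0` route with the sharp integration):

  `|R₀(t)| ≤ (1/√a)(0.12023/a + 0.062664/a² + 0.055715/a³ + 0.0078/a⁴ + 59.96/a⁵ + 1.8137/t)`

(`≈ 0.48 t^{−3/4}`; Gabcke's printed constants are `0.127` resp. `0.47` "grob"). Because the six constants
are RATIONAL, the evaluator needs no constant table and no bridging identity beyond `ring`: the ordinary
`RSTables` suffice. Compared with the evaluator on the crude explicit bound (`RSEval.hardyZBoxX`,
`HardyZRiemannSiegelEvaluationExplicit.lean`, `≈ 0.92 t^{−3/4}`) the remainder part of the radius is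
`× 0.52`; on the tree's landed certificate plans for `10³/10⁴/10⁵` no sample point needs re-positioning
(verify-eng-1, GABCKE-K0-ROUTE). Provided for future certificates; no landed height depends on it.

* `RSEval.hardyZBoxS`, `RSEval.mem_hardyZBoxS` — evaluator and soundness (NO named fact); the run
  checker on top of it (`RSCert.checkChunkS` etc.) is `RiemannHypothesisUpToRSCertificateSharp.lean`.

## References

* W. Gabcke, Dissertation Göttingen 1979: Einleitung (6) p. 3; §3.1 Satz 3.1.3; Satz 3.2.2 p. 55. [Gabcke1979]
* R. P. Brent, Math. Comp. 33 (1979), §3–§4. [Brent1979]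
* H. M. Edwards, *Riemann's Zeta Function* (1974), §6.5, §8.2. [EdwardsZeta1974]
-/

open Finset Complex
open Literature.Analysis.ValidatedNumerics Literature.Analysis.ValidatedNumerics.NumericsMP
open Literature.NumberTheory.LFunctions Literature.NumberTheory.LFunctions.ZetaNumerics
open scoped Real

namespace Literature.NumberTheory.LFunctions

namespace RSEval

/-! ## 1. The evaluator with the proved SHARP remainder (rational constants) -/

/-- **The certified Riemann–Siegel evaluator of Hardy's `Z` with the PROVED SHARP remainder bound** at
the dyadic point `t = p/2^e` with claimed main-sum length `N` (checked: `2πN² < t < 2π(N+1)²`,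
`t ≥ 200`, `1 ≤ N ≤` table size): as `hardyZBox`, an interval
`2 Re(e^{iϑ_m} W) ± ⌈2·(2K(¼)/t)·‖W‖⌉ + (−1)^{N+1} u F(z) ± g`, but with
`g = u (0.12023 w + 0.062664 w² + 0.055715 w³ + 0.0078 w⁴ + 59.96 w⁵ + 1.8137/t)`, `u = e^{−L/4} = a^{−1/2}`,
`w = u²`, the interval value of `Gabcke.abs_R0_le_sharp_rat` (six RATIONAL constants: no constant
table, the ordinary `RSTables` suffice). [cite: Gabcke1979, Einleitung (6) p. 3] -/
def hardyZBoxS (R : RSTables) (p e N : ℕ) : Option MI :=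
  let S := R.T.S
  let tI := MI.ofFrac S p (2 ^ e)
  if 200 * 2 ^ e ≤ p ∧ 1 ≤ N ∧ N ≤ R.T.N ∧
      (R.T.piI.mulInt ((2 * N * N : ℕ) : ℤ)).hi < tI.lo ∧
      tI.hi < (R.T.piI.mulInt ((2 * (N + 1) * (N + 1) : ℕ) : ℤ)).lo then
    match logT R p e, rsW R tI N with
    | some lt, some W =>
      let L := (lt.sub R.log2).sub R.logPi
      let thm := (((MI.mul S tI L).sub tI).divNat 2).sub (R.T.piI.divNat 8)
      match MC.expI S R.T.KI R.T.kI R.T.piI thm, MI.divPos S R.twoK tI,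
        MI.exp S R.T.Kexp R.T.kexp (L.divNat 2), MI.exp S R.T.Kexp R.T.kexp ((L.divNat 4).neg),
        MI.divPos S (MI.ofInt S 1) tI with
      | some E, some dl, some aI, some ainv, some tinv =>
        let main := ((MC.mul S E W).re).mulInt 2
        let rad : ℤ := Numerics.cdiv (2 * dl.hi * W.absHi) S
        let zI := (MI.ofInt S 1).sub ((aI.sub (MI.ofInt S N)).mulInt 2)
        match FBox R zI with
        | some FI =>
          let c0 := (MI.mul S ainv FI).mulInt ((-1) ^ (N + 1))
          let w := MI.mul S ainv ainv
          let w2 := MI.mul S w w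
          let w3 := MI.mul S w2 w
          let w4 := MI.mul S w3 w
          let w5 := MI.mul S w4 w
          let g := MI.mul S ainv ((((((MI.mul S (MI.ofFrac S 12023 100000) w).add
            (MI.mul S (MI.ofFrac S 62664 1000000) w2)).add (MI.mul S (MI.ofFrac S 55715 1000000) w3)).add
            (MI.mul S (MI.ofFrac S 78 10000) w4)).add (MI.mul S (MI.ofFrac S 5996 100) w5)).add
            (MI.mul S (MI.ofFrac S 18137 10000) tinv))
          some (((main.widen rad).add c0).add ⟨-g.hi, g.hi⟩)
        | none => none
      | _, _, _, _, _ => none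
    | _, _ => none
  else none

/-! ## 2. Soundness -/

section Soundness

/-- `|2 Re(e^{iϑ} W) − 2 Re(e^{iφ} W)| ≤ 2 |ϑ − φ| ‖W‖`. [folklore] -/
private lemma abs_two_re_sub_le'' (θ φ : ℝ) (W : ℂ) :
    |2 * (Complex.exp ((θ : ℂ) * I) * W).re - 2 * (Complex.exp ((φ : ℂ) * I) * W).re| ≤
      2 * |θ - φ| * ‖W‖ := by
  rw [← mul_sub, ← Complex.sub_re, ← sub_mul, abs_mul, abs_two, mul_assoc]
  gcongr
  refine (Complex.abs_re_le_norm _).trans ?_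
  rw [norm_mul]
  gcongr
  exact Numerics.CB.norm_exp_I_sub_exp_I_le θ φ

/-- `a = e^{L/2}` and `1/√a = e^{−L/4}` with `L = log(t/2π)`, `t > 0`. [folklore] -/
private lemma gabckeA_eq'' {t : ℝ} (ht : 0 < t) :
    Gabcke.a t = Real.exp (Real.log (t / (2 * π)) / 2) ∧
      (Real.sqrt (Gabcke.a t))⁻¹ = Real.exp (-(Real.log (t / (2 * π)) / 4)) := by
  have hq : 0 < t / (2 * π) := by positivity
  have ha : Gabcke.a t = Real.exp (Real.log (t / (2 * π)) / 2) := by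
    unfold Gabcke.a
    rw [Real.sqrt_eq_rpow, Real.rpow_def_of_pos hq]
    congr 1; ring
  refine ⟨ha, ?_⟩
  rw [ha, Real.sqrt_eq_rpow, ← Real.exp_mul, ← Real.exp_neg]
  congr 1; ring

/-- **Soundness of the Riemann–Siegel evaluator with the proved SHARP remainder — no named fact.** For
valid tables, `hardyZBoxS R p e N = some B` implies `Z(p/2^e) ∈ B`. The remainder is controlled by
`Gabcke.abs_R0_le_sharp_rat` (proved in the tree), whose hypotheses hold: `t ≥ 200 ≥ 8`,
`√(t/2π) ∉ ℤ` at the dyadic `t` (`Gabcke.int_ne_a_dyadic`), and `cos πz ≠ 0` from the sign check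
inside `FBox`. [cite: Gabcke1979, Satz 3.2.2 p. 55] -/
theorem mem_hardyZBoxS {R : RSTables} (hR : R.Valid) {p e N : ℕ}
    {B : MI} (h : hardyZBoxS R p e N = some B) :
    MI.mem R.T.S (hardyZ ((p : ℝ) / 2 ^ e)) B := by
  have hS := hR.T_valid.S_pos
  have hSr : (0 : ℝ) < R.T.S := by exact_mod_cast hS
  have hpi := hR.T_valid.mem_pi
  unfold hardyZBoxS at h
  simp only at h
  split_ifs at h with hc
  obtain ⟨h200, hN1, hNN, hlow, hupp⟩ := hc
  -- the sample point
  set t : ℝ := (p : ℝ) / 2 ^ e with htdef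
  have h2e : (0 : ℝ) < 2 ^ e := by positivity
  have ht200 : 200 ≤ t := by
    rw [htdef, le_div_iff₀ h2e]
    have : ((200 * 2 ^ e : ℕ) : ℝ) ≤ p := by exact_mod_cast h200
    push_cast at this
    exact this
  have ht0 : 0 < t := by linarith
  have hp1 : 1 ≤ p := by
    by_contra hp
    push Not at hp
    interval_cases p
    simp [htdef] at ht200; linarith
  have htI : MI.mem R.T.S t (MI.ofFrac R.T.S p (2 ^ e)) := by
    have := MI.mem_ofFrac R.T.S (p : ℤ) (q := 2 ^ e) (by positivity)
    have e1 : ((p : ℤ) : ℝ) / ((2 ^ e : ℕ) : ℝ) = t := by rw [htdef]; push_cast; ring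
    rwa [e1] at this
  -- `N = Gabcke.N t`
  have hlow' : 2 * π * (N : ℝ) ^ 2 < t := by
    have hm : MI.mem R.T.S (2 * π * (N : ℝ) ^ 2) (R.T.piI.mulInt ((2 * N * N : ℕ) : ℤ)) := by
      have := MI.mem_mulInt hpi ((2 * N * N : ℕ) : ℤ)
      convert this using 1; push_cast; ring
    exact MI.lt_of_hi_lt_lo hm htI hlow
  have hupp' : t < 2 * π * ((N : ℝ) + 1) ^ 2 := by
    have hm : MI.mem R.T.S (2 * π * ((N : ℝ) + 1) ^ 2)
        (R.T.piI.mulInt ((2 * (N + 1) * (N + 1) : ℕ) : ℤ)) := by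
      have := MI.mem_mulInt hpi ((2 * (N + 1) * (N + 1) : ℕ) : ℤ)
      convert this using 1; push_cast; ring
    exact MI.lt_of_hi_lt_lo htI hm hupp
  have hNeq : Gabcke.N t = N := gabckeN_eq hlow' hupp'
  split at h
  · rename_i lt W hlt hW
    split at h
    · rename_i E dl aI ainv tinv hE hdl haI hainv htinv
      split at h
      · rename_i FI hFI
        simp only [Option.some.injEq] at h
        subst h
        -- enclosures
        have hlt' : MI.mem R.T.S (Real.log t) lt := by
          unfold logT at hlt
          split at hlt
          · rename_i lp hlp
            simp only [Option.some.injEq] at hlt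
            subst hlt
            rw [logNatK_eq] at hlp
            have h1 := MI.mem_logNat hS hlp
            have h2 := MI.mem_mulInt hR.mem_log2 (e : ℤ)
            have := MI.mem_sub h1 h2
            convert this using 1
            have hp0 : (0 : ℝ) < p := by exact_mod_cast hp1
            rw [htdef, Real.log_div hp0.ne' (by positivity), Real.log_pow]
            push_cast
            ring
          · simp at hlt
        set Lr : ℝ := Real.log (t / (2 * π)) with hLr
        have hL : MI.mem R.T.S Lr ((lt.sub R.log2).sub R.logPi) := by
          have := MI.mem_sub (MI.mem_sub hlt' hR.mem_log2) hR.mem_logPi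
          convert this using 1
          rw [hLr, Real.log_div ht0.ne' (by positivity), Real.log_mul (by norm_num) Real.pi_pos.ne']
          ring
        set θm : ℝ := t / 2 * Real.log (t / (2 * π)) - t / 2 - π / 8 with hθm
        have hthm : MI.mem R.T.S θm ((((MI.mul R.T.S (MI.ofFrac R.T.S p (2 ^ e))
            ((lt.sub R.log2).sub R.logPi)).sub (MI.ofFrac R.T.S p (2 ^ e))).divNat 2).sub
            (R.T.piI.divNat 8)) := by
          have := MI.mem_sub (MI.mem_divNat (MI.mem_sub (MI.mem_mul hS htI hL) htI) (n := 2)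
            (by norm_num)) (MI.mem_divNat hpi (n := 8) (by norm_num))
          convert this using 1
          rw [hθm, hLr]; push_cast; ring
        have hE' := MC.mem_expI hS hpi hE hthm
        have hW' := mem_rsW hR htI N hNN hW
        have hdl' : MI.mem R.T.S (2 * stirlingVertRate (1 / 4) / t) dl :=
          MI.mem_divPos hS hdl hR.mem_twoK htI
        obtain ⟨haeq, hainveq⟩ := gabckeA_eq'' ht0
        have haI' : MI.mem R.T.S (Gabcke.a t) aI := by
          rw [haeq]
          exact MI.mem_exp hS haI (MI.mem_divNat hL (n := 2) (by norm_num))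
        have hainv' : MI.mem R.T.S ((Real.sqrt (Gabcke.a t))⁻¹) ainv := by
          rw [hainveq]
          refine MI.mem_exp hS hainv ?_
          have := MI.mem_neg (MI.mem_divNat hL (n := 4) (by norm_num))
          convert this using 2
          rw [hLr]; push_cast; ring
        have hz : MI.mem R.T.S (Gabcke.z t)
            ((MI.ofInt R.T.S 1).sub ((aI.sub (MI.ofInt R.T.S N)).mulInt 2)) := by
          have := MI.mem_sub (MI.mem_ofInt R.T.S 1) (MI.mem_mulInt (MI.mem_sub haI'
            (MI.mem_ofInt R.T.S (N : ℤ))) 2)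
          have e1 : ((1 : ℤ) : ℝ) - (Gabcke.a t - ((N : ℤ) : ℝ)) * ((2 : ℤ) : ℝ) = Gabcke.z t := by
            unfold Gabcke.z; rw [hNeq]; push_cast; ring
          rwa [e1] at this
        obtain ⟨hcos, hF⟩ := mem_FBox hR hz hFI
        -- (i) the main sum
        have hmainBox : MI.mem R.T.S (2 * (Complex.exp ((θm : ℂ) * I) * Wsum N t).re)
            ((MC.mul R.T.S E W).re.mulInt 2) := by
          have := MI.mem_mulInt (MC.mem_mul hS hE' hW').1 2
          convert this using 1
          push_cast; ring
        have hmain : MI.mem R.T.S (Gabcke.mainSum t)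
            (((MC.mul R.T.S E W).re.mulInt 2).widen (Numerics.cdiv (2 * dl.hi * W.absHi) R.T.S)) := by
          apply MI.mem_widen hmainBox
          have hθ := abs_riemannSiegelTheta_sub_stirling_le (t := t) (by linarith)
          rw [← hθm] at hθ
          have h1 := abs_two_re_sub_le'' (riemannSiegelTheta t) θm (Wsum N t)
          have hWn := MC.norm_le_absHi hW'
          have hd2 := hdl'.2
          have hδ0 : 0 ≤ 2 * stirlingVertRate (1 / 4) / t := by
            unfold stirlingVertRate; positivity
          have hdlhi : (0 : ℝ) ≤ dl.hi := le_trans (by positivity) hd2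
          have hprod : (2 * stirlingVertRate (1 / 4) / t * R.T.S) * (‖Wsum N t‖ * R.T.S) ≤
              (dl.hi : ℝ) * W.absHi := mul_le_mul hd2 hWn (by positivity) hdlhi
          have hkey : |Gabcke.mainSum t - 2 * (Complex.exp ((θm : ℂ) * I) * Wsum N t).re| * R.T.S ≤
              2 * (dl.hi : ℝ) * W.absHi / R.T.S := by
            rw [mainSum_eq_re, hNeq, le_div_iff₀ hSr]
            calc |2 * (Complex.exp ((riemannSiegelTheta t : ℂ) * I) * Wsum N t).re -
                  2 * (Complex.exp ((θm : ℂ) * I) * Wsum N t).re| * R.T.S * R.T.S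
                ≤ 2 * |riemannSiegelTheta t - θm| * ‖Wsum N t‖ * R.T.S * R.T.S := by gcongr
              _ ≤ 2 * (2 * stirlingVertRate (1 / 4) / t) * ‖Wsum N t‖ * R.T.S * R.T.S := by gcongr
              _ = 2 * ((2 * stirlingVertRate (1 / 4) / t * R.T.S) * (‖Wsum N t‖ * R.T.S)) := by ring
              _ ≤ 2 * ((dl.hi : ℝ) * W.absHi) := by linarith [hprod]
              _ = 2 * (dl.hi : ℝ) * W.absHi := by ring
          have hc := Numerics.div_le_cdiv (a := 2 * dl.hi * W.absHi) (b := (R.T.S : ℤ))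
            (by exact_mod_cast hS)
          push_cast at hc
          exact hkey.trans hc
        -- (ii) the `C₀` term
        have hc0 : MI.mem R.T.S ((-1 : ℝ) ^ (N + 1) * Gabcke.F (Gabcke.z t) / Real.sqrt (Gabcke.a t))
            ((MI.mul R.T.S ainv FI).mulInt ((-1) ^ (N + 1))) := by
          have := MI.mem_mulInt (MI.mem_mul hS hainv' hF) ((-1) ^ (N + 1))
          convert this using 1
          push_cast
          rw [div_eq_mul_inv]; ring
        -- (iii) the proved sharp remainder bound, in interval arithmetic
        have hw := MI.mem_mul hS hainv' hainv'
        have hw2 := MI.mem_mul hS hw hw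
        have hw3 := MI.mem_mul hS hw2 hw
        have hw4 := MI.mem_mul hS hw3 hw
        have hw5 := MI.mem_mul hS hw4 hw
        have htinv' : MI.mem R.T.S (1 / t) tinv := by
          have := MI.mem_divPos hS htinv (MI.mem_ofInt R.T.S 1) htI
          simpa using this
        have hq1 : MI.mem R.T.S (0.12023 : ℝ) (MI.ofFrac R.T.S 12023 100000) := by
          have := MI.mem_ofFrac R.T.S 12023 (q := 100000) (by norm_num); convert this using 1; norm_num
        have hq2 : MI.mem R.T.S (0.062664 : ℝ) (MI.ofFrac R.T.S 62664 1000000) := by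
          have := MI.mem_ofFrac R.T.S 62664 (q := 1000000) (by norm_num); convert this using 1; norm_num
        have hq3 : MI.mem R.T.S (0.055715 : ℝ) (MI.ofFrac R.T.S 55715 1000000) := by
          have := MI.mem_ofFrac R.T.S 55715 (q := 1000000) (by norm_num); convert this using 1; norm_num
        have hq4 : MI.mem R.T.S (0.0078 : ℝ) (MI.ofFrac R.T.S 78 10000) := by
          have := MI.mem_ofFrac R.T.S 78 (q := 10000) (by norm_num); convert this using 1; norm_num
        have hq5 : MI.mem R.T.S (59.96 : ℝ) (MI.ofFrac R.T.S 5996 100) := by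
          have := MI.mem_ofFrac R.T.S 5996 (q := 100) (by norm_num); convert this using 1; norm_num
        have hq6 : MI.mem R.T.S (1.8137 : ℝ) (MI.ofFrac R.T.S 18137 10000) := by
          have := MI.mem_ofFrac R.T.S 18137 (q := 10000) (by norm_num); convert this using 1; norm_num
        have hg := MI.mem_mul hS hainv' (MI.mem_add (MI.mem_add (MI.mem_add (MI.mem_add (MI.mem_add
          (MI.mem_mul hS hq1 hw) (MI.mem_mul hS hq2 hw2)) (MI.mem_mul hS hq3 hw3))
          (MI.mem_mul hS hq4 hw4)) (MI.mem_mul hS hq5 hw5)) (MI.mem_mul hS hq6 htinv'))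
        set g := MI.mul R.T.S ainv ((((((MI.mul R.T.S (MI.ofFrac R.T.S 12023 100000) (MI.mul R.T.S ainv ainv)).add
            (MI.mul R.T.S (MI.ofFrac R.T.S 62664 1000000) (MI.mul R.T.S (MI.mul R.T.S ainv ainv) (MI.mul R.T.S ainv ainv)))).add
            (MI.mul R.T.S (MI.ofFrac R.T.S 55715 1000000) (MI.mul R.T.S (MI.mul R.T.S (MI.mul R.T.S ainv ainv)
              (MI.mul R.T.S ainv ainv)) (MI.mul R.T.S ainv ainv)))).add
            (MI.mul R.T.S (MI.ofFrac R.T.S 78 10000) (MI.mul R.T.S (MI.mul R.T.S (MI.mul R.T.S (MI.mul R.T.S ainv ainv)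
              (MI.mul R.T.S ainv ainv)) (MI.mul R.T.S ainv ainv)) (MI.mul R.T.S ainv ainv)))).add
            (MI.mul R.T.S (MI.ofFrac R.T.S 5996 100) (MI.mul R.T.S (MI.mul R.T.S (MI.mul R.T.S (MI.mul R.T.S
              (MI.mul R.T.S ainv ainv) (MI.mul R.T.S ainv ainv)) (MI.mul R.T.S ainv ainv))
              (MI.mul R.T.S ainv ainv)) (MI.mul R.T.S ainv ainv)))).add
            (MI.mul R.T.S (MI.ofFrac R.T.S 18137 10000) tinv)) with hgdef
        have hA : 0 < Gabcke.a t := Real.sqrt_pos.2 (div_pos ht0 (by positivity))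
        have hsq : 0 < Real.sqrt (Gabcke.a t) := Real.sqrt_pos.2 hA
        have hbound0 := Gabcke.abs_R0_le_sharp_rat (t := t) (by linarith)
          (by rw [htdef]; exact Gabcke.int_ne_a_dyadic hp1) hcos
        have hww : (Real.sqrt (Gabcke.a t))⁻¹ * (Real.sqrt (Gabcke.a t))⁻¹ = (Gabcke.a t)⁻¹ := by
          rw [← mul_inv, Real.mul_self_sqrt hA.le]
        have hbound : |Gabcke.R0 t| ≤ (Real.sqrt (Gabcke.a t))⁻¹ *
            (0.12023 * ((Real.sqrt (Gabcke.a t))⁻¹ * (Real.sqrt (Gabcke.a t))⁻¹)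
              + 0.062664 * (((Real.sqrt (Gabcke.a t))⁻¹ * (Real.sqrt (Gabcke.a t))⁻¹)
                  * ((Real.sqrt (Gabcke.a t))⁻¹ * (Real.sqrt (Gabcke.a t))⁻¹))
              + 0.055715 * (((Real.sqrt (Gabcke.a t))⁻¹ * (Real.sqrt (Gabcke.a t))⁻¹)
                  * ((Real.sqrt (Gabcke.a t))⁻¹ * (Real.sqrt (Gabcke.a t))⁻¹)
                  * ((Real.sqrt (Gabcke.a t))⁻¹ * (Real.sqrt (Gabcke.a t))⁻¹))
              + 0.0078 * (((Real.sqrt (Gabcke.a t))⁻¹ * (Real.sqrt (Gabcke.a t))⁻¹)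
                  * ((Real.sqrt (Gabcke.a t))⁻¹ * (Real.sqrt (Gabcke.a t))⁻¹)
                  * ((Real.sqrt (Gabcke.a t))⁻¹ * (Real.sqrt (Gabcke.a t))⁻¹)
                  * ((Real.sqrt (Gabcke.a t))⁻¹ * (Real.sqrt (Gabcke.a t))⁻¹))
              + 59.96 * (((Real.sqrt (Gabcke.a t))⁻¹ * (Real.sqrt (Gabcke.a t))⁻¹)
                  * ((Real.sqrt (Gabcke.a t))⁻¹ * (Real.sqrt (Gabcke.a t))⁻¹)
                  * ((Real.sqrt (Gabcke.a t))⁻¹ * (Real.sqrt (Gabcke.a t))⁻¹)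
                  * ((Real.sqrt (Gabcke.a t))⁻¹ * (Real.sqrt (Gabcke.a t))⁻¹)
                  * ((Real.sqrt (Gabcke.a t))⁻¹ * (Real.sqrt (Gabcke.a t))⁻¹))
              + 1.8137 * (1 / t)) := by
          rw [hww]
          refine hbound0.trans (le_of_eq ?_)
          have hA0 : Gabcke.a t ≠ 0 := hA.ne'
          field_simp
        have hR0 : MI.mem R.T.S (Gabcke.R0 t) ⟨-g.hi, g.hi⟩ := by
          have hgS := hg.2
          have habs : |Gabcke.R0 t| * R.T.S ≤ (g.hi : ℝ) :=
            le_trans (mul_le_mul_of_nonneg_right hbound hSr.le) hgS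
          have habs' : |Gabcke.R0 t * R.T.S| ≤ (g.hi : ℝ) := by
            rw [abs_mul, abs_of_pos hSr]; exact habs
          have h2 := abs_le.1 habs'
          refine ⟨?_, h2.2⟩
          push_cast
          exact h2.1
        -- assemble `Z = main + C₀-term + R₀`
        have hsum := MI.mem_add (MI.mem_add hmain hc0) hR0
        have e1 : hardyZ t = Gabcke.mainSum t +
            (-1 : ℝ) ^ (N + 1) * Gabcke.F (Gabcke.z t) / Real.sqrt (Gabcke.a t) + Gabcke.R0 t := by
          unfold Gabcke.R0; rw [hNeq]; ring
        rw [e1]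
        exact hsum
      · simp at h
    · simp at h
  · simp at h


end Soundness

end RSEval

end Literature.NumberTheory.LFunctions
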